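import Summits.BirchSwinnertonDyer.BirchSwinnertonDyer.Theorems.KolyvaginDepthDoorDepthTableKuriharaDecisiveTriple22481a1
import Literature.NumberTheory.EllipticCurves.ShaPTorsionVanishingHigherRank
import Literature.NumberTheory.EllipticCurves.ComplexMultiplicationNotSemistable
import Literature.NumberTheory.EllipticCurves.BurungaleSkinner2023.Curve14a1TwistsCertificate
import HarnessLib

/-!
# Route `KolyvaginDepthDoor`, crux `KolyvaginDepthSupplyKN` (stmt-BirchSwinnertonDyer-22820) —
# DEPTH TABLE v23, RANK THREE: THE TWO DOORS AGREE AT `22481a1` @ `11`, BY NAME — Stein–Wuthrich 2013 Thm. 1.1 (the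
# cyclotomic λ-door: `Ш(22481a1/ℚ)[11] = 0`) and Sakamoto 2022 (the Kurihara door at the decisive triple) PREDICT the tree's
# kit record: `δ̃_{89·199·661}(22481a1)` is a `11`-adic unit (recorded: `δ̃ ≡ 1 (mod 11)`, `cert_22481a1_s4`)

Helper file of the lead prover of line `levelone` (kdd-p1 g27; `--supports stmt-BirchSwinnertonDyer-22820 --as helper`);
it closes nothing and BSD is NOT proved by it.

The route's thesis pairs two non-equivalent per-curve criteria for `corank Ш(E)[p^∞] = 0` at rank `≥ 2` — the λ-door
(Stein–Wuthrich 2013) and the depth door (Kolyvagin / Kurihara) — «whose per-curve AGREEMENT is a falsifiable instrument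
row». v23 (`…KuriharaDecisiveTriple22481a1`) made the E-side of a RANK-THREE row two-way at the recorded depth-three
level: «`Ш(22481a1)[11] = 0` ⟺ unit `δ̃_{11706971}`». This file composes it with Stein–Wuthrich BY NAME on the literal
integral model (`N = 22481 ≤ 30 000`, non-CM by the multiplicative prime `22481`, `rank = 3 ≥ 2` in the kernel, `11` good
ordinary, `ρ̄_{E,11}` onto — all kernel certificates of `…DecisiveTriple22481a1Cert`): GRANTED SW Thm. 1.1 and the Kurihara-side
named facts, the mod-`11` Kurihara number of `22481a1` at `89·199·661` is a unit for every admissible datum — which is what the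
kit job `j093451` recorded (`δ̃ ≡ 1`). A recorded ZERO there would have refuted the conjunction of the named facts. §1:
`not_hasCM_int`, `conductorNorm_int` (the two SW side conditions on the literal model); §2:
`sha_inf_torsionBy_eq_bot_11_of_steinWuthrich`, `kuriharaUnit_11_11706971_of_steinWuthrich`. CONDITIONAL on the named
facts displayed (`hSW`; `hKim`, `hnf`, `hMaz`, `hSakR`); per curve; nothing class-wide; BSD is NOT proved by any of this.

References: [SteinWuthrich2013] Thm. 1.1 (p. 1758); [Sakamoto2022pSelmer] Lemma 4.4, Lemma 4.6 (1); [Kim2022StructureSelmer]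
Thm. 1.11; [BuhlerGrossZagier1985] §1; [CremonaAlgorithms1997] Table 1 (22481a1); [SilvermanATAEC1994] Thm. II.6.4.
-/

set_option linter.dupNamespace false

noncomputable section

open scoped Classical NumberField

namespace Summit.BirchSwinnertonDyer.BirchSwinnertonDyer.Theorems.KolyvaginDepthDoor

open Literature.NumberTheory.EllipticCurves Literature.NumberTheory.EllipticCurves.ModularForms
  WeierstrassCurve NumberField IsDedekindDomain
open Summit.BirchSwinnertonDyer.BirchSwinnertonDyer.Theorems
open Summit.BirchSwinnertonDyer.BirchSwinnertonDyer.Rank2Observatory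
open Summit.BirchSwinnertonDyer.BirchSwinnertonDyer.Rank1Residual (IntModel.hasMultiplicativeReductionAtPrime_of_intModel)

namespace C22481a1

/-! ## §1 The two Stein–Wuthrich side conditions on the literal integral model -/

/-- **`22481a1` (literal model `[1, -1, 1, 6, 2]`) is not CM**: multiplicative reduction at `5077` (`22481 ∣ Δ = -22481`, `22481 ∤ c₄ = -303`), while a CM curve over `ℚ` has no multiplicative prime. [cite: SilvermanATAEC1994, Thm. II.6.4 (PDF p. 148)]
[cite: CremonaAlgorithms1997, Table 1 (22481a1)] -/
theorem not_hasCM_int :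
    haveI := isElliptic_c22481a1;
    ¬ ((⟨1, -1, 1, 6, 2⟩ : WeierstrassCurve ℤ).map (Int.castRingHom ℚ)).HasCM := by
  haveI := isElliptic_c22481a1
  haveI := isGloballyMinimal_c22481a1
  haveI := Fact.mk (by norm_num : Nat.Prime 22481)
  intro hCM
  exact not_hasMultiplicativeReductionAtPrime_of_hasCM _ hCM 22481
    (IntModel.hasMultiplicativeReductionAtPrime_of_intModel intModel_int 22481 (by decide +kernel) (by decide +kernel))

/-- **`N(22481a1) = 5077`** on the literal model (semistable: `gcd(Δ, c₄) = gcd(5077, 336) = 1`, `N = rad Δ = 5077`).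
[cite: CremonaAlgorithms1997, Table 1 (22481a1)] [cite: Silverman1994, IV.10.2 (a),(b)] -/
theorem conductorNorm_int :
    haveI := isElliptic_c22481a1;
    ((⟨1, -1, 1, 6, 2⟩ : WeierstrassCurve ℤ).map (Int.castRingHom ℚ)).conductorNorm ℤ = 22481 := by
  haveI := isElliptic_c22481a1
  have hbc : (⟨1, -1, 1, 6, 2⟩ : WeierstrassCurve ℤ).map (Int.castRingHom ℚ) =
      (⟨1, -1, 1, 6, 2⟩ : WeierstrassCurve ℤ).baseChange ℚ := by
    ext <;> simp [WeierstrassCurve.baseChange, WeierstrassCurve.map]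
  haveI : ((⟨1, -1, 1, 6, 2⟩ : WeierstrassCurve ℤ).baseChange ℚ).IsElliptic := by rw [← hbc]; infer_instance
  rw [hbc]
  refine BurungaleSkinner2023.conductorNorm_baseChange_int_of_isCoprime _
    (by rw [Int.isCoprime_iff_gcd_eq_one]; decide +kernel) (k := 1) ?_ (by decide +kernel) (by decide +kernel)
  rw [Nat.squarefree_iff_nodup_primeFactorsList (by norm_num)]; simp

/-! ## §2 Stein–Wuthrich ⟹ the recorded Kurihara unit -/

/-- **`Ш(22481a1/ℚ)[11] = 0` BY NAME (Stein–Wuthrich 2013 Thm. 1.1) on the literal model**, all side conditions kernel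
certificates: non-CM (`not_hasCM_int`), `2 ≤ 3 = rank` (KERNEL-2DESC-CL `Rank2Observatory.C22481a1.mordellWeilRank_eq_three`),
`N = 22481 ≤ 30 000` (`conductorNorm_int`), `11` good ordinary (`goodOrdinary_11`), `ρ̄_{E,11}` onto (`hasSurjectiveModNGaloisRep_11`).
CONDITIONAL on `hSW`; per curve; BSD is not proved by it. [cite: SteinWuthrich2013, Thm. 1.1 (p. 1758)] -/
theorem sha_inf_torsionBy_eq_bot_11_of_steinWuthrich
    (hSW : SteinWuthrich2013_sha_inf_torsionBy_eq_bot_of_two_le_rank) :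
    haveI := isElliptic_c22481a1; haveI := Fact.mk (by norm_num : Nat.Prime 11);
    (((⟨1, -1, 1, 6, 2⟩ : WeierstrassCurve ℤ).map (Int.castRingHom ℚ)).sha ⊓
      AddSubgroup.torsionBy ((⟨1, -1, 1, 6, 2⟩ : WeierstrassCurve ℤ).map (Int.castRingHom ℚ)).galH1 ((11 : ℕ) : ℤ) :
      AddSubgroup _) = ⊥ := by
  haveI := isElliptic_c22481a1
  haveI := isGloballyMinimal_c22481a1
  haveI := Fact.mk (by norm_num : Nat.Prime 11)
  exact hSW _ not_hasCM_int
    (by rw [Summit.BirchSwinnertonDyer.BirchSwinnertonDyer.Rank2Observatory.C22481a1.mordellWeilRank_eq_three]; norm_num)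
    (by rw [conductorNorm_int]; norm_num) 11 (by norm_num) (by norm_num) goodOrdinary_11.1 goodOrdinary_11.2
    hasSurjectiveModNGaloisRep_11

/-- **THE TWO DOORS AGREE AT `22481a1` @ `11`: Stein–Wuthrich ⟹ a UNIT mod-`11` Kurihara number at the recorded depth-three
level `11039309 = 89·199·661`** (for every datum `D` at level `N_E` with `7 ∤ c_D` and the period transfer): SW Thm. 1.1
(`sha_inf_torsionBy_eq_bot_11_of_steinWuthrich`) fed into the `⟹` direction of v23's two-way theorem
`sha_inf_torsionBy_eq_bot_iff_kuriharaClaim_11_11706971` (Sakamoto at depth three + the kernel localisation matrix of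
the three certified points). The kit record `cert_22481a1_s4` found `δ̃ ≡ 1 (mod 11)` there: the prediction holds. CONDITIONAL on
`hSW`, `hKim`, `hnf`, `hMaz`, `hSakR` BY NAME; per curve; BSD is not proved by it. [cite: SteinWuthrich2013, Thm. 1.1 (p. 1758)]
[cite: Sakamoto2022pSelmer, Lemma 4.4, Lemma 4.6 (1)] [cite: CremonaAlgorithms1997, Table 1 (22481a1)] -/
theorem kuriharaUnit_11_11706971_of_steinWuthrich
    (hSW : SteinWuthrich2013_sha_inf_torsionBy_eq_bot_of_two_le_rank)
    (hKim : Kim2022_card_selmerGroup_le_pow_of_kuriharaNumber_ne_zero)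
    (hnf : exists_isNewformOf) (hMaz : mazur_not_dvd_maninConstant_of_odd)
    (hSakR : Sakamoto2022_kuriharaNumber_ne_zero_of_localizationInjective) :
    haveI := isElliptic_c22481a1; haveI := isGloballyMinimal_c22481a1;
      haveI : NeZero (((⟨1, -1, 1, 6, 2⟩ : WeierstrassCurve ℤ).map (Int.castRingHom ℚ)).conductorNorm ℤ) := neZero_conductorNorm_of_isElliptic _;
      haveI := Fact.mk (by norm_num : Nat.Prime 11);
    ∀ (D : ModularParametrizationData ((⟨1, -1, 1, 6, 2⟩ : WeierstrassCurve ℤ).map (Int.castRingHom ℚ)) (((⟨1, -1, 1, 6, 2⟩ : WeierstrassCurve ℤ).map (Int.castRingHom ℚ)).conductorNorm ℤ)), ¬ ((11 : ℕ) : ℤ) ∣ D.maninConstant →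
      (∃ u : ℚ, ‖(u : ℚ_[11])‖ = 1 ∧ ((⟨1, -1, 1, 6, 2⟩ : WeierstrassCurve ℤ).map (Int.castRingHom ℚ)).realPeriodRat = u * plusPeriod D.f) →
      ∃ ψ : (q : ℕ) → (ZMod q)ˣ →* Multiplicative (ZMod 11),
        (∀ q ∈ (11706971 : ℕ).primeFactors, Function.Surjective (ψ q)) ∧ kuriharaNumber D.f 11 11706971 ψ ≠ 0 :=
  (sha_inf_torsionBy_eq_bot_iff_kuriharaClaim_11_11706971 hKim hnf hMaz hSakR).mp
    (sha_inf_torsionBy_eq_bot_11_of_steinWuthrich hSW)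

end C22481a1

end Summit.BirchSwinnertonDyer.BirchSwinnertonDyer.Theorems.KolyvaginDepthDoor

end
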